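import Mathlib

/-!
# Tier7/Line3/DivisorBound — the divisor bound `∏_v (1 + e_v) ≤ C_ε · N^ε` in the kernel

Filer: t7-L1-p3 (gen 3, prover-pub-hodge-repro2-t7-L1-p3-g3-0), TARGET line STATUS l. 15059. Lane: SUPPORT for
Line 3's version-(ii) isolation (L3-ARGUMENT.md §2c / §2e (a′)); NOT a line, NOT a device.

WHAT IT SUPPLIES. x1's census row for the `b_bound` field of `DominantSide` (STATUS l. 15010 (2)) bounds the finite
factors of the geometric side by a product of box counts `∏_v (1 + e₁(v))(1 + e₂(v))` (SplitOrbitBox p670387) and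
then needs the DIVISOR BOUND `∏_v (1 + e_v) ≤ C_ε · N^ε` (`N = ∏_v q_v^{e_v}` the norm of the denominator ideal) to
get the growth exponent `d′ = ε` — «the crude bound `∏ (1 + e_v) ≤ N` would give `d′ = [F:ℚ] ≥ 2` and BREAK the
exponent condition `α > β + d′`; the divisor bound is load-bearing, not cosmetic» — and carried it as a PRINTED input
(Hardy–Wright Thm 315 for `ℤ`, «for `O_F` the same proof»). This file PROVES it from Mathlib, in three forms:

* `exists_const_prod_one_add_le` (abstract): for any index type `ι`, weights `q : ι → ℕ` with `2 ≤ q i` and finite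
  sublevel sets `{i | q i ≤ B}`, and any `ε > 0`, there is `C > 0` with
  `∏_{i ∈ s} (1 + e i) ≤ C · (∏_{i ∈ s} (q i)^(e i))^ε` for EVERY finite set `s` and EVERY `e : ι → ℕ`;
* `exists_const_card_divisors_le` (`ℕ`): `#(n.divisors) ≤ C · n^ε` for all `n ≥ 1` (the classical statement);
* `exists_const_finprod_one_add_multiplicity_le` (Dedekind): for a Dedekind domain `R` with finite ideal norms
  (`Module.Free ℤ R`, `Module.Finite ℤ R`, `CharZero R` — e.g. the ring of integers of a number field,
  `exists_const_finprod_one_add_multiplicity_le_ringOfIntegers`): for every non-zero ideal `I`,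
  `∏ᶠ_𝔭 (1 + ord_𝔭 I) ≤ C · (absNorm I)^ε`, the product over the height-one primes `𝔭` of `R`.

PROOF (one paragraph). Put `θ_i := (q i)^ε > 1`. Off the FINITE set `S_ε := {i | q i ≤ ⌈2^{1/ε}⌉}` one has `θ_i ≥ 2`,
so `1 + e ≤ 2^e ≤ θ_i^e`; on `S_ε`, Bernoulli `θ^e = (1 + (θ-1))^e ≥ 1 + e(θ-1) ≥ min(1, θ-1)·(1 + e)` gives
`1 + e ≤ c_i · θ_i^e` with `c_i := 1/min(1, θ_i − 1) ≥ 1` (and `c_i = 1` off `S_ε`). Multiply: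
`∏_s (1 + e_i) ≤ (∏_s c_i) · ∏_s θ_i^{e_i} ≤ (∏_{S_ε} c_i) · (∏_s (q_i)^{e_i})^ε`. So `C_ε = ∏_{q_i ≤ 2^{1/ε}} 1/min(1, q_i^ε − 1)`.

DICTIONARY to the real objects (in words, as everything about `X` in this tier): `ι` = the finite places of `F`
(= the height-one primes of `O_F`), `q_v = N(𝔭_v)`, `e_v = ord_v` of the denominator ideal of `1 − κ′` resp. `κ′`
(x1 l. 15010 (1)–(2)); `N = N(𝔞)`; the sublevel finiteness is `Ideal.finite_setOf_absNorm_le`. Nothing about the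
step (P) is claimed; no non-vanishing is proved.

§8(d) (uses an L-value-free non-vanishing device): NO — a counting inequality.
-/

namespace Summit.Ventures.HodgeRepro2.Tier7.Line3.DivisorBound

open Finset

/-- Bernoulli's inequality in the form used below: for `1 ≤ θ` and `e : ℕ`,
`min 1 (θ − 1) · (1 + e) ≤ θ ^ e`. -/
theorem min_one_mul_one_add_le_pow {θ : ℝ} (hθ : 1 ≤ θ) (e : ℕ) :
    min 1 (θ - 1) * (1 + (e : ℝ)) ≤ θ ^ e := by
  have hδ : 0 ≤ θ - 1 := sub_nonneg.mpr hθ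
  have hB : 1 + (e : ℝ) * (θ - 1) ≤ (1 + (θ - 1)) ^ e :=
    one_add_mul_le_pow (by linarith) e
  have h1 : min 1 (θ - 1) ≤ 1 := min_le_left _ _
  have h2 : min 1 (θ - 1) ≤ θ - 1 := min_le_right _ _
  have he : (0 : ℝ) ≤ e := Nat.cast_nonneg e
  have hθ' : 1 + (θ - 1) = θ := by ring
  calc min 1 (θ - 1) * (1 + (e : ℝ)) = min 1 (θ - 1) + (e : ℝ) * min 1 (θ - 1) := by ring
    _ ≤ 1 + (e : ℝ) * (θ - 1) := add_le_add h1 (mul_le_mul_of_nonneg_left h2 he)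
    _ ≤ (1 + (θ - 1)) ^ e := hB
    _ = θ ^ e := by rw [hθ']

/-- For `q ≥ 2` and `ε > 0`, `0 < min 1 (q^ε − 1)`. -/
theorem min_one_rpow_sub_one_pos {ε : ℝ} (hε : 0 < ε) {q : ℕ} (hq : 2 ≤ q) :
    0 < min 1 ((q : ℝ) ^ ε - 1) := by
  apply lt_min one_pos
  have h1 : (1 : ℝ) < (q : ℝ) := by exact_mod_cast (by omega : 1 < q)
  have : (1 : ℝ) < (q : ℝ) ^ ε := Real.one_lt_rpow h1 hε
  linarith

/-- The per-weight constant `c_ε(q) := (min 1 (q^ε − 1))⁻¹` of the divisor bound is positive for `q ≥ 2`. -/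
theorem inv_min_pos {ε : ℝ} (hε : 0 < ε) {q : ℕ} (hq : 2 ≤ q) :
    0 < (min 1 ((q : ℝ) ^ ε - 1))⁻¹ :=
  inv_pos.mpr (min_one_rpow_sub_one_pos hε hq)

/-- `c_ε(q) = (min 1 (q^ε − 1))⁻¹ ≥ 1` for `q ≥ 2`. -/
theorem one_le_inv_min {ε : ℝ} (hε : 0 < ε) {q : ℕ} (hq : 2 ≤ q) :
    1 ≤ (min 1 ((q : ℝ) ^ ε - 1))⁻¹ := by
  rw [one_le_inv₀ (min_one_rpow_sub_one_pos hε hq)]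
  exact min_le_left _ _

/-- `c_ε(q) = (min 1 (q^ε − 1))⁻¹ = 1` as soon as `q^ε ≥ 2`. -/
theorem inv_min_eq_one {ε : ℝ} {q : ℕ} (h : 2 ≤ (q : ℝ) ^ ε) :
    (min 1 ((q : ℝ) ^ ε - 1))⁻¹ = 1 := by
  rw [min_eq_left (by linarith), inv_one]

/-- The one-weight divisor bound: `1 + e ≤ c_ε(q) · (q^e)^ε` with `c_ε(q) = (min 1 (q^ε − 1))⁻¹`, for
`q ≥ 2`, `ε > 0`, `e : ℕ`. -/
theorem one_add_le_inv_min_mul {ε : ℝ} (hε : 0 < ε) {q : ℕ} (hq : 2 ≤ q) (e : ℕ) :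
    1 + (e : ℝ) ≤ (min 1 ((q : ℝ) ^ ε - 1))⁻¹ * ((q : ℝ) ^ e) ^ ε := by
  have hq0 : (0 : ℝ) ≤ (q : ℝ) := Nat.cast_nonneg q
  have hq1 : (1 : ℝ) ≤ (q : ℝ) := by exact_mod_cast (by omega : 1 ≤ q)
  have hθ : 1 ≤ (q : ℝ) ^ ε := Real.one_le_rpow hq1 hε.le
  have hmin := min_one_rpow_sub_one_pos hε hq
  have hB := min_one_mul_one_add_le_pow hθ e
  have hpow : ((q : ℝ) ^ ε) ^ e = ((q : ℝ) ^ e) ^ ε := by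
    rw [← Real.rpow_natCast, ← Real.rpow_mul hq0, mul_comm, Real.rpow_mul hq0, Real.rpow_natCast]
  rw [← hpow, ← div_eq_inv_mul, le_div_iff₀ hmin, mul_comm]
  exact hB

/-- **The divisor bound, abstract form.** Let `q : ι → ℕ` be weights with `2 ≤ q i` whose sublevel sets
`{i | q i ≤ B}` are finite, and let `ε > 0`. Then there is `C > 0` such that for every finite set `s` of
indices and every exponent function `e : ι → ℕ`,
`∏_{i ∈ s} (1 + e i) ≤ C · (∏_{i ∈ s} (q i)^(e i))^ε`.
(`C = ∏_{q i ≤ ⌈2^{1/ε}⌉} (min 1 ((q i)^ε − 1))⁻¹`.) -/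
theorem exists_const_prod_one_add_le {ι : Type*} (q : ι → ℕ) (hq : ∀ i, 2 ≤ q i)
    (hfin : ∀ B : ℕ, {i | q i ≤ B}.Finite) {ε : ℝ} (hε : 0 < ε) :
    ∃ C : ℝ, 0 < C ∧ ∀ (s : Finset ι) (e : ι → ℕ),
      (∏ i ∈ s, (1 + (e i : ℝ))) ≤ C * (∏ i ∈ s, ((q i : ℝ) ^ (e i))) ^ ε := by
  classical
  set Q : ℕ := ⌈(2 : ℝ) ^ (1 / ε)⌉₊ with hQ
  set S : Finset ι := (hfin Q).toFinset with hS
  refine ⟨∏ i ∈ S, (min 1 ((q i : ℝ) ^ ε - 1))⁻¹, prod_pos (fun i _ => inv_min_pos hε (hq i)), fun s e => ?_⟩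
  -- off `S` the constant is `1`
  have hlarge : ∀ i, Q < q i → (min 1 ((q i : ℝ) ^ ε - 1))⁻¹ = 1 := by
    intro i hi
    apply inv_min_eq_one
    have h1 : (2 : ℝ) ^ (1 / ε) ≤ (q i : ℝ) := by
      calc (2 : ℝ) ^ (1 / ε) ≤ (Q : ℝ) := Nat.le_ceil _
        _ ≤ (q i : ℝ) := by exact_mod_cast hi.le
    calc (2 : ℝ) = ((2 : ℝ) ^ (1 / ε)) ^ ε := by
          rw [← Real.rpow_mul (by norm_num), one_div_mul_cancel hε.ne', Real.rpow_one]
      _ ≤ (q i : ℝ) ^ ε := Real.rpow_le_rpow (by positivity) h1 hε.le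
  -- the pointwise bound
  have hpt : ∀ i ∈ s, (1 + (e i : ℝ)) ≤ (min 1 ((q i : ℝ) ^ ε - 1))⁻¹ * ((q i : ℝ) ^ (e i)) ^ ε :=
    fun i _ => one_add_le_inv_min_mul hε (hq i) (e i)
  -- the product of the constants over `s` is at most the product over `S`
  have hcst : (∏ i ∈ s, (min 1 ((q i : ℝ) ^ ε - 1))⁻¹) ≤ ∏ i ∈ S, (min 1 ((q i : ℝ) ^ ε - 1))⁻¹ := by
    calc (∏ i ∈ s, (min 1 ((q i : ℝ) ^ ε - 1))⁻¹) = ∏ i ∈ s ∩ S, (min 1 ((q i : ℝ) ^ ε - 1))⁻¹ := by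
          symm
          apply prod_subset inter_subset_left
          intro i hi hni
          have hiQ : Q < q i := by
            by_contra h
            exact hni (mem_inter.mpr ⟨hi, (hfin Q).mem_toFinset.mpr (not_lt.mp h)⟩)
          exact hlarge i hiQ
      _ ≤ ∏ i ∈ S, (min 1 ((q i : ℝ) ^ ε - 1))⁻¹ :=
          prod_le_prod_of_subset_of_one_le inter_subset_right
            (fun i _ => (inv_min_pos hε (hq i)).le) (fun i _ _ => one_le_inv_min hε (hq i))
  calc (∏ i ∈ s, (1 + (e i : ℝ)))
      ≤ ∏ i ∈ s, ((min 1 ((q i : ℝ) ^ ε - 1))⁻¹ * ((q i : ℝ) ^ (e i)) ^ ε) :=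
        prod_le_prod (fun i _ => by positivity) hpt
    _ = (∏ i ∈ s, (min 1 ((q i : ℝ) ^ ε - 1))⁻¹) * ∏ i ∈ s, ((q i : ℝ) ^ (e i)) ^ ε := prod_mul_distrib
    _ = (∏ i ∈ s, (min 1 ((q i : ℝ) ^ ε - 1))⁻¹) * (∏ i ∈ s, ((q i : ℝ) ^ (e i))) ^ ε := by
        rw [Real.finsetProd_rpow _ _ (fun i _ => by positivity)]
    _ ≤ (∏ i ∈ S, (min 1 ((q i : ℝ) ^ ε - 1))⁻¹) * (∏ i ∈ s, ((q i : ℝ) ^ (e i))) ^ ε :=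
        mul_le_mul_of_nonneg_right hcst (by positivity)

/-- The divisor bound for finitely supported exponents `e : ι →₀ ℕ` (the product over the support). -/
theorem exists_const_finsupp_prod_one_add_le {ι : Type*} (q : ι → ℕ) (hq : ∀ i, 2 ≤ q i)
    (hfin : ∀ B : ℕ, {i | q i ≤ B}.Finite) {ε : ℝ} (hε : 0 < ε) :
    ∃ C : ℝ, 0 < C ∧ ∀ e : ι →₀ ℕ,
      (∏ i ∈ e.support, (1 + (e i : ℝ))) ≤ C * (∏ i ∈ e.support, ((q i : ℝ) ^ (e i))) ^ ε := by
  obtain ⟨C, hC, h⟩ := exists_const_prod_one_add_le q hq hfin hε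
  exact ⟨C, hC, fun e => h e.support e⟩

/-- **The classical divisor bound.** For every `ε > 0` there is `C > 0` with `#(n.divisors) ≤ C · n^ε`
for all `n ≥ 1` (Hardy–Wright's `d(n) = O(n^ε)`, here proved, not displayed). -/
theorem exists_const_card_divisors_le {ε : ℝ} (hε : 0 < ε) :
    ∃ C : ℝ, 0 < C ∧ ∀ n : ℕ, n ≠ 0 → ((n.divisors.card : ℕ) : ℝ) ≤ C * (n : ℝ) ^ ε := by
  obtain ⟨C, hC, h⟩ := exists_const_prod_one_add_le (fun p : ℕ => max p 2) (fun p => le_max_right _ _)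
    (fun B => (Set.finite_Iic B).subset (fun p hp => Set.mem_Iic.mpr (le_trans (le_max_left _ _) hp)))
    hε
  refine ⟨C, hC, fun n hn => ?_⟩
  have hfac := h n.primeFactors (fun p => n.factorization p)
  have hL : ((n.divisors.card : ℕ) : ℝ) = ∏ p ∈ n.primeFactors, (1 + (n.factorization p : ℝ)) := by
    rw [Nat.card_divisors hn, Nat.cast_prod]
    refine prod_congr rfl (fun p _ => ?_)
    push_cast
    ring
  have hR : (∏ p ∈ n.primeFactors, ((max p 2 : ℕ) : ℝ) ^ (n.factorization p)) = n := by
    have hmax : ∀ p ∈ n.primeFactors,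
        ((max p 2 : ℕ) : ℝ) ^ (n.factorization p) = (p : ℝ) ^ (n.factorization p) := by
      intro p hp
      rw [max_eq_left (Nat.prime_of_mem_primeFactors hp).two_le]
    rw [prod_congr rfl hmax]
    have hself := Nat.prod_factorization_pow_eq_self hn
    rw [Finsupp.prod, Nat.support_factorization] at hself
    exact_mod_cast hself
  rw [hL, ← hR]
  exact hfac

section Dedekind

open IsDedekindDomain

variable (R : Type*) [CommRing R] [IsDedekindDomain R] [Module.Free ℤ R] [Module.Finite ℤ R]
  [CharZero R]

omit [CharZero R] in
/-- The absolute norm of a height-one prime of a Dedekind domain with finite ideal norms is at least `2`. -/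
theorem two_le_absNorm_asIdeal (v : HeightOneSpectrum R) : 2 ≤ Ideal.absNorm v.asIdeal := by
  have h0 : Ideal.absNorm v.asIdeal ≠ 0 := by
    rw [Ne, Ideal.absNorm_eq_zero_iff]
    exact v.ne_bot
  have h1 : Ideal.absNorm v.asIdeal ≠ 1 := by
    rw [Ne, Ideal.absNorm_eq_one_iff]
    exact v.isPrime.ne_top
  omega

/-- Only finitely many height-one primes have absolute norm `≤ B`. -/
theorem finite_setOf_absNorm_asIdeal_le (B : ℕ) :
    {v : HeightOneSpectrum R | Ideal.absNorm v.asIdeal ≤ B}.Finite := by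
  have hinj : Function.Injective (fun v : HeightOneSpectrum R => v.asIdeal) :=
    fun v w h => HeightOneSpectrum.ext h
  exact (Ideal.finite_setOf_absNorm_le (S := R) B).preimage hinj.injOn

/-- **The divisor bound for ideals of a Dedekind domain with finite norms** (e.g. the ring of integers of a
number field): for every `ε > 0` there is `C > 0` such that every non-zero ideal `I` satisfies
`∏ᶠ_𝔭 (1 + ord_𝔭 I) ≤ C · (absNorm I)^ε`, the product running over the height-one primes `𝔭` of `R`
(`ord_𝔭 I = multiplicity 𝔭 I`). -/
theorem exists_const_finprod_one_add_multiplicity_le {ε : ℝ} (hε : 0 < ε) :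
    ∃ C : ℝ, 0 < C ∧ ∀ I : Ideal R, I ≠ ⊥ →
      (∏ᶠ v : HeightOneSpectrum R, (1 + (multiplicity v.asIdeal I : ℝ))) ≤
        C * (Ideal.absNorm I : ℝ) ^ ε := by
  classical
  obtain ⟨C, hC, h⟩ := exists_const_prod_one_add_le
    (fun v : HeightOneSpectrum R => Ideal.absNorm v.asIdeal)
    (two_le_absNorm_asIdeal R) (finite_setOf_absNorm_asIdeal_le R) hε
  refine ⟨C, hC, fun I hI => ?_⟩
  -- the primes dividing `I`
  set s : Finset (HeightOneSpectrum R) := (Ideal.finite_factors hI).toFinset with hs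
  have hmem : ∀ v : HeightOneSpectrum R, v ∉ s → multiplicity v.asIdeal I = 0 := by
    intro v hv
    by_contra hne
    apply hv
    rw [hs, (Ideal.finite_factors hI).mem_toFinset]
    exact dvd_of_multiplicity_pos (Nat.pos_of_ne_zero hne)
  -- the left side as a finite product
  have hL : (∏ᶠ v : HeightOneSpectrum R, (1 + (multiplicity v.asIdeal I : ℝ))) =
      ∏ v ∈ s, (1 + (multiplicity v.asIdeal I : ℝ)) := by
    apply finprod_eq_prod_of_mulSupport_subset
    intro v hv
    by_contra hvs
    apply hv
    simp [hmem v hvs]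
  -- `I` as a finite product of prime powers, and its norm
  have hI' : I = ∏ v ∈ s, v.asIdeal ^ multiplicity v.asIdeal I := by
    calc I = ∏ᶠ v : HeightOneSpectrum R, v.asIdeal ^ multiplicity v.asIdeal I :=
          (Ideal.finprod_heightOneSpectrum_pow_multiplicity hI).symm
      _ = ∏ v ∈ s, v.asIdeal ^ multiplicity v.asIdeal I := by
          apply finprod_eq_prod_of_mulSupport_subset
          intro v hv
          by_contra hvs
          apply hv
          simp [hmem v hvs]
  have hN : (Ideal.absNorm I : ℝ) =
      ∏ v ∈ s, ((Ideal.absNorm v.asIdeal : ℕ) : ℝ) ^ (multiplicity v.asIdeal I) := by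
    conv_lhs => rw [hI']
    rw [map_prod, Nat.cast_prod]
    refine prod_congr rfl (fun v _ => ?_)
    rw [map_pow, Nat.cast_pow]
  rw [hL, hN]
  exact h s (fun v => multiplicity v.asIdeal I)

end Dedekind

/-- The divisor bound for the ring of integers `𝓞 K` of a number field `K`: for every `ε > 0` there is
`C > 0` with `∏ᶠ_𝔭 (1 + ord_𝔭 I) ≤ C · (N I)^ε` for every non-zero ideal `I` of `𝓞 K` (the form used for the
denominator ideals of the double-coset invariants at the split places, STATUS l. 15010). -/
theorem exists_const_finprod_one_add_multiplicity_le_ringOfIntegers (K : Type*) [Field K]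
    [NumberField K] {ε : ℝ} (hε : 0 < ε) :
    ∃ C : ℝ, 0 < C ∧ ∀ I : Ideal (NumberField.RingOfIntegers K), I ≠ ⊥ →
      (∏ᶠ v : IsDedekindDomain.HeightOneSpectrum (NumberField.RingOfIntegers K),
        (1 + (multiplicity v.asIdeal I : ℝ))) ≤ C * (Ideal.absNorm I : ℝ) ^ ε :=
  exists_const_finprod_one_add_multiplicity_le _ hε

end Summit.Ventures.HodgeRepro2.Tier7.Line3.DivisorBound
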